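import Mathlib
import Literature.NumberTheory.LFunctions.Zhang2022.SmoothWeightSegmentTail
import HarnessLib

/-!
# Zhang (2022) §15 p. 80 / §17 (17.8): "integrating term by term" on the lines `σ = −1/2`, `𝔍(−1)` —
# the reflected (`1 − s`) form: a finite `ψ`-polynomial against an infinite `ψ̄`-series

Topic `Literature/NumberTheory/LFunctions/Zhang2022` (Landau–Siegel audit tree; verdict-neutral).
Y. Zhang, *Discrete mean estimates and the Landau–Siegel zero*, arXiv:2211.02515v1 (2022)
[Zhang2022LandauSiegel] — **an unrefereed manuscript under adjudication** (cell siegel-zhang, D-0069).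
Companion of `Zhang2022/SmoothWeightMellin.lean` and `Zhang2022/SmoothWeightSegmentTail.lean`. Those
treat `A(s)·(Σ_{n∈S} b(n)n^{s−1})·ω(s)` with the INFINITE series `A(s) = Σ_m a(m)m^{−s}` absolutely
convergent on the line (`σ = 3/2`, the `I₄⁺`/`Θ₂` side). At the two LEFT sites of the manuscript the
roles are reversed — a FINITE `ψ`-polynomial `Σ_{m∈S} a(m)m^{−s}` (`B(s,ψ)` of (15.1); `B·G·N·N` of
(17.8)) against an INFINITE `ψ̄`-series in `1 − s`, absolutely convergent because `Re(1−s) > 1`: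

* `Z22:§15.u009–u012` [Z22 p. 80, tex L4033–4056]: on `σ = −1/2`,
  "`(1/2πi)∫_{(−1/2)} (Σ_m k̃(m)ψ̄(Dm)(Dm)^{s−1}) B(s,ψ)ω(s) ds`", then `Z22:§15.u010` term by term;
* `Z22:(17.8)` [Z22 p. 98, tex L4790–4806]: on `𝔍(−1)`, "`L(1−s−β₁,ψ̄)F(1−s,ψ̄)/L(1−s,ψ̄) =
  Σ_n ϱ*(n)ψ̄(n)n^{s−1}` … In a way similar to the proof of (17.3) we deduce (17.8)".

The reflection `s ↦ 1 − s` carries these to the right-hand setting: `1 − s₀ = s̄₀ = s₀(−t₀)`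
(`one_sub_s0`), `ω_{t₀}(1 − s) = ω_{−t₀}(s)` (`omega_one_sub`), `v ↦ −v` on the line through `𝔍(z)`
(`one_sub_linePoint`). PROVED here (UNCONDITIONAL; no (A), no named fact):

* `integral_sum_mul_LSeries_mul_omega` — **term by term, reflected form**: for `S ∌ 0`, `b` with
  `Σ|b(n)|n^{−(1/2−z)} < ∞` and `s = z + s₀ + iv`,
  `(1/2π)∫_ℝ (Σ_{m∈S} a(m)m^{−s})·(Σ_n b(n)n^{s−1})·ω(s) dv
   = Σ_n Σ_{m∈S} b(n)n^{−s̄₀}·a(m)m^{s̄₀−1}·exp{−𝓛₂² log²(m/n)}`, `s̄₀ = s₀(−t₀) = 1 − s₀`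
  (equivalently `Σ_nΣ_m a(m)m^{−s₀}b(n)n^{s₀−1}exp{−𝓛₂²log²(n/m)}`, `term_reflect`), i.e. exactly the
  shape on which `Zhang2022/SmoothWeightDiagonal.lean` extracts the diagonal (with `t₀ ↦ −t₀`);
* `norm_lineIntegral_sub_segInt_le'` — **"moving/replacing the segment `𝔍(z)` by the line" for the
  reflected integrand**: `‖(1/2π)∫_ℝ − (1/2πi)∫_{𝔍(z)}‖ ≤ (Σ_{m∈S}|a(m)|m^{−(z+1/2)})·
  (Σ_n |b(n)|n^{−(1/2−z)})·e^{(z²−𝓛₁²)/(4𝓛₂²)}`.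

Nothing here bears on Theorems 1–2 of the source or on the cell's verdict.

## References

* Y. Zhang, arXiv:2211.02515v1 (2022), §2 (2.15); §7 p. 13; §15 p. 80 (proof of (15.4));
  §17 p. 98 ((17.8)). [cite: Zhang2022LandauSiegel, §15 p. 80; §17 (17.8)]
-/

noncomputable section

open Complex Real Set MeasureTheory

namespace Literature.NumberTheory.LFunctions.Zhang2022

namespace SmoothWeight

/-! ## The reflection `s ↦ 1 − s` -/

/-- `1 − s₀ = s̄₀ = 1/2 − 2πit₀ = s₀(−t₀)`. [cite: Zhang2022LandauSiegel, §2 (2.15)] -/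
theorem one_sub_s0 (t₀ : ℝ) : 1 - s0 t₀ = s0 (-t₀) := by
  rw [s0_def, s0_def]; push_cast; ring

/-- **`ω` is symmetric under `s ↦ 1 − s` up to `t₀ ↦ −t₀`**: `ω_{t₀}(1 − s) = ω_{−t₀}(s)` ((2.15):
`(1 − s − s₀)² = (s − s̄₀)²`). [cite: Zhang2022LandauSiegel, §2 (2.15)] -/
theorem omega_one_sub (L₂ t₀ : ℝ) (s : ℂ) : omega L₂ t₀ (1 - s) = omega L₂ (-t₀) s := by
  rw [omega_def, omega_def]
  congr 2
  rw [← one_sub_s0]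
  ring

/-- The reflected line point: `1 − ((−z) + s̄₀ + i(−v)) = z + s₀ + iv`.
[cite: Zhang2022LandauSiegel, §7 p. 13] -/
theorem one_sub_linePoint (t₀ z v : ℝ) :
    1 - (((-z : ℝ) : ℂ) + s0 (-t₀) + ((-v : ℝ) : ℂ) * I) = (z : ℂ) + s0 t₀ + v * I := by
  rw [← one_sub_s0]; push_cast; ring

/-- Termwise dictionary between the reflected and the direct shape (`m, n ≥ 1`):
`b(n)n^{−s̄₀}·a(m)m^{s̄₀−1} = a(m)m^{−s₀}·b(n)n^{s₀−1}` and `log²(m/n) = log²(n/m)`, so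
`term b s̄₀ n·(a(m)m^{s̄₀−1})·e^{−𝓛₂²log²(m/n)} = term a s₀ m·(b(n)n^{s₀−1})·e^{−𝓛₂²log²(n/m)}`.
[cite: Zhang2022LandauSiegel, §15 p. 80; §17 (17.8)] -/
theorem term_reflect {L₂ : ℝ} (t₀ : ℝ) (a b : ℕ → ℂ) {m n : ℕ} (hm : m ≠ 0) (hn : n ≠ 0) :
    LSeries.term b (s0 (-t₀)) n * (a m * (m : ℂ) ^ (s0 (-t₀) - 1)) *
        cexp (-(L₂ : ℂ) ^ 2 * (Real.log ((m : ℝ) / n) : ℂ) ^ 2)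
      = LSeries.term a (s0 t₀) m * (b n * (n : ℂ) ^ (s0 t₀ - 1)) *
          cexp (-(L₂ : ℂ) ^ 2 * (Real.log ((n : ℝ) / m) : ℂ) ^ 2) := by
  have hm' : (0 : ℝ) < m := Nat.cast_pos.mpr (Nat.pos_of_ne_zero hm)
  have hn' : (0 : ℝ) < n := Nat.cast_pos.mpr (Nat.pos_of_ne_zero hn)
  have hmc : (m : ℂ) ≠ 0 := Nat.cast_ne_zero.mpr hm
  have hnc : (n : ℂ) ≠ 0 := Nat.cast_ne_zero.mpr hn
  have hlog : Real.log ((m : ℝ) / n) = -Real.log ((n : ℝ) / m) := by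
    rw [← Real.log_inv, inv_div]
  rw [hlog, LSeries.term_of_ne_zero hn, LSeries.term_of_ne_zero hm, ← one_sub_s0]
  push_cast
  rw [neg_sq, show (1 : ℂ) - s0 t₀ - 1 = -s0 t₀ by ring, Complex.cpow_neg,
    show (s0 t₀ - 1 : ℂ) = -(1 - s0 t₀) by ring, Complex.cpow_neg]
  have h1 : (n : ℂ) ^ (1 - s0 t₀) ≠ 0 := fun h => hnc ((cpow_eq_zero_iff _ _).mp h).1
  have h2 : (m : ℂ) ^ (s0 t₀) ≠ 0 := fun h => hmc ((cpow_eq_zero_iff _ _).mp h).1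
  field_simp

/-! ## Term by term on the left: finite `Σ_m a(m)m^{−s}` against `Σ_n b(n)n^{s−1}` -/

/-- **"Integrating term by term", reflected form** (`Z22:§15.u009–u010` [Z22 p. 80, tex L4037–4043],
`σ = −1/2`; `Z22:(17.8)` [p. 98, tex L4806], `𝔍(−1)`): for a finite Dirichlet polynomial
`Σ_{m∈S} a(m)m^{−s}` (`0 ∉ S`), a series `Σ_n b(n)n^{s−1} = Σ_n b(n)n^{−(1−s)}` absolutely convergent on
the line (`Σ|b(n)|n^{−(1/2−z)} < ∞`), and `ω` (2.15), with `s = z + s₀ + iv`: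
`(1/2π)∫_ℝ (Σ_m a(m)m^{−s})(Σ_n b(n)n^{s−1})ω(s) dv = Σ_n Σ_{m∈S} b(n)n^{−s̄₀} a(m)m^{s̄₀−1} e^{−𝓛₂²log²(m/n)}`,
`s̄₀ = s₀(−t₀)` — by the reflection `s ↦ 1 − s`, `v ↦ −v` from `integral_LSeries_mul_sum_mul_omega`.
[cite: Zhang2022LandauSiegel, §15 p. 80 (proof of (15.4)); §17 (17.8)] -/
theorem integral_sum_mul_LSeries_mul_omega {L₂ : ℝ} (hL : 0 < L₂) (t₀ z : ℝ) (a : ℕ → ℂ)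
    {S : Finset ℕ} (hS : 0 ∉ S) {b : ℕ → ℂ} (hb : LSeriesSummable b ((1 / 2 - z : ℝ) : ℂ)) :
    (1 / (2 * π) : ℂ) * ∫ v : ℝ,
        (∑ m ∈ S, a m * (m : ℂ) ^ (-((z : ℂ) + s0 t₀ + v * I))) *
          LSeries b (1 - ((z : ℂ) + s0 t₀ + v * I)) * omega L₂ t₀ ((z : ℂ) + s0 t₀ + v * I)
      = ∑' n : ℕ, ∑ m ∈ S, LSeries.term b (s0 (-t₀)) n * (a m * (m : ℂ) ^ (s0 (-t₀) - 1)) *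
          cexp (-(L₂ : ℂ) ^ 2 * (Real.log ((m : ℝ) / n) : ℂ) ^ 2) := by
  have hb' : LSeriesSummable b (((-z) + 1 / 2 : ℝ) : ℂ) := by
    rw [show ((-z) + 1 / 2 : ℝ) = 1 / 2 - z by ring]; exact hb
  -- the direct-form integrand at `(b, a, −z, −t₀)`
  set G : ℝ → ℂ := fun w => LSeries b (((-z : ℝ) : ℂ) + s0 (-t₀) + w * I) *
      (∑ m ∈ S, a m * (m : ℂ) ^ ((((-z : ℝ) : ℂ) + s0 (-t₀) + w * I) - 1)) *
      omega L₂ (-t₀) (((-z : ℝ) : ℂ) + s0 (-t₀) + w * I) with hG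
  -- pointwise reflection: our integrand at `v` is `G(−v)`
  have hpt : ∀ v : ℝ, (∑ m ∈ S, a m * (m : ℂ) ^ (-((z : ℂ) + s0 t₀ + v * I))) *
        LSeries b (1 - ((z : ℂ) + s0 t₀ + v * I)) * omega L₂ t₀ ((z : ℂ) + s0 t₀ + v * I)
      = G (-v) := by
    intro v
    have e : (z : ℂ) + s0 t₀ + v * I = 1 - (((-z : ℝ) : ℂ) + s0 (-t₀) + ((-v : ℝ) : ℂ) * I) :=
      (one_sub_linePoint t₀ z v).symm
    rw [hG]
    simp only []
    rw [e, sub_sub_cancel, omega_one_sub, neg_sub, Complex.ofReal_neg]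
    ring
  simp_rw [hpt]
  rw [integral_neg_eq_self G volume, hG]
  exact integral_LSeries_mul_sum_mul_omega hL (-t₀) (-z) hb' a hS

/-- **"Replacing the segment `𝔍(z)` by the line with a negligible error", reflected form** (§15 p. 80
"moving the segment `𝔍(−α)` to `𝔍(−1)` … replaced by the line `σ = −1/2`"; §17 p. 98 (17.8)): with
`𝔍(z) = {z + s₀ + iv : |v| ≤ 𝓛₁}`, `0 ∉ S`, `Σ|b(n)|n^{−(1/2−z)} < ∞`, `𝓛₁ ≥ 0`:
`‖(1/2π)∫_ℝ (Σ_m a(m)m^{−s})(Σ_n b(n)n^{s−1})ω(s)dv − (1/2πi)∫_{𝔍(z)}(same)ds‖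
 ≤ (Σ_{m∈S}|a(m)|m^{−(z+1/2)})·(Σ_n|b(n)|n^{−(1/2−z)})·e^{(z²−𝓛₁²)/(4𝓛₂²)}`.
[cite: Zhang2022LandauSiegel, §15 p. 80 (proof of (15.4)); §17 (17.8)] -/
theorem norm_lineIntegral_sub_segInt_le' {L₂ : ℝ} (hL : 0 < L₂) (t₀ z : ℝ) (a : ℕ → ℂ)
    {S : Finset ℕ} (hS : 0 ∉ S) {b : ℕ → ℂ} (hb : LSeriesSummable b ((1 / 2 - z : ℝ) : ℂ))
    {L₁ : ℝ} (hL₁ : 0 ≤ L₁) :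
    ‖(1 / (2 * π) : ℂ) * (∫ v : ℝ,
          (∑ m ∈ S, a m * (m : ℂ) ^ (-((z : ℂ) + s0 t₀ + v * I))) *
            LSeries b (1 - ((z : ℂ) + s0 t₀ + v * I)) * omega L₂ t₀ ((z : ℂ) + s0 t₀ + v * I)) -
        Lemma81.segInt t₀ L₁ z (fun s => (∑ m ∈ S, a m * (m : ℂ) ^ (-s)) * LSeries b (1 - s) *
          omega L₂ t₀ s)‖
      ≤ (∑ m ∈ S, ‖a m‖ * (m : ℝ) ^ (-(z + 1 / 2))) *
          (∑' n : ℕ, ‖LSeries.term b ((1 / 2 - z : ℝ) : ℂ) n‖) *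
          Real.exp ((z ^ 2 - L₁ ^ 2) / (4 * L₂ ^ 2)) := by
  have hb' : LSeriesSummable b (((-z) + 1 / 2 : ℝ) : ℂ) := by
    rw [show ((-z) + 1 / 2 : ℝ) = 1 / 2 - z by ring]; exact hb
  set G : ℝ → ℂ := fun w => LSeries b (((-z : ℝ) : ℂ) + s0 (-t₀) + w * I) *
      (∑ m ∈ S, a m * (m : ℂ) ^ ((((-z : ℝ) : ℂ) + s0 (-t₀) + w * I) - 1)) *
      omega L₂ (-t₀) (((-z : ℝ) : ℂ) + s0 (-t₀) + w * I) with hG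
  have hpt : ∀ v : ℝ, (∑ m ∈ S, a m * (m : ℂ) ^ (-((z : ℂ) + s0 t₀ + v * I))) *
        LSeries b (1 - ((z : ℂ) + s0 t₀ + v * I)) * omega L₂ t₀ ((z : ℂ) + s0 t₀ + v * I)
      = G (-v) := by
    intro v
    have e : (z : ℂ) + s0 t₀ + v * I = 1 - (((-z : ℝ) : ℂ) + s0 (-t₀) + ((-v : ℝ) : ℂ) * I) :=
      (one_sub_linePoint t₀ z v).symm
    rw [hG]
    simp only []
    rw [e, sub_sub_cancel, omega_one_sub, neg_sub, Complex.ofReal_neg]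
    ring
  -- the full-line integral
  have hline : ∫ v : ℝ, (∑ m ∈ S, a m * (m : ℂ) ^ (-((z : ℂ) + s0 t₀ + v * I))) *
      LSeries b (1 - ((z : ℂ) + s0 t₀ + v * I)) * omega L₂ t₀ ((z : ℂ) + s0 t₀ + v * I)
      = ∫ w : ℝ, G w := by
    simp_rw [hpt]; exact integral_neg_eq_self G volume
  -- the segment integral
  have hseg : Lemma81.segInt t₀ L₁ z (fun s => (∑ m ∈ S, a m * (m : ℂ) ^ (-s)) *
        LSeries b (1 - s) * omega L₂ t₀ s)
      = Lemma81.segInt (-t₀) L₁ (((-z : ℝ) : ℂ)) (fun s => LSeries b s *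
          (∑ m ∈ S, a m * (m : ℂ) ^ (s - 1)) * omega L₂ (-t₀) s) := by
    rw [Lemma81.segInt_def, Lemma81.segInt_def]
    congr 1
    have h1 : (fun v : ℝ => (∑ m ∈ S, a m * (m : ℂ) ^ (-((z : ℂ) + s0 t₀ + v * I))) *
        LSeries b (1 - ((z : ℂ) + s0 t₀ + v * I)) * omega L₂ t₀ ((z : ℂ) + s0 t₀ + v * I))
        = fun v : ℝ => G (-v) := funext hpt
    rw [h1, intervalIntegral.integral_comp_neg (fun w => G w), neg_neg]
  rw [hline, hseg, hG]
  have key := norm_lineIntegral_sub_segInt_le hL (-t₀) (-z) hb' a hS hL₁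
  have e1 : ((-z) + 1 / 2 - 1 : ℝ) = -(z + 1 / 2) := by ring
  have e2 : ((-z : ℝ) ^ 2) = z ^ 2 := by ring
  rw [e1, e2, show ((-z) + 1 / 2 : ℝ) = 1 / 2 - z by ring] at key
  calc _ ≤ (∑' n : ℕ, ‖LSeries.term b ((1 / 2 - z : ℝ) : ℂ) n‖) *
          (∑ m ∈ S, ‖a m‖ * (m : ℝ) ^ (-(z + 1 / 2))) *
          Real.exp ((z ^ 2 - L₁ ^ 2) / (4 * L₂ ^ 2)) := key
    _ = _ := by ring

end SmoothWeight

end Literature.NumberTheory.LFunctions.Zhang2022
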